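import Summits.CriticalPhenomena.PercolationContinuityZ3.Theorems.PercNearOneGluingNoHeavyLowerTailQ7PsiMaxRobust
import HarnessLib

/-!
# `NoHeavyLowerTail` (stmt-CriticalPhenomena-4575) — the glued pre-FKG inequality (41) at three relays, MAX-ROBUST form:
# no designation hypothesis, one deficit (measured in the UNGLUED graph)

Support file (`--supports stmt-CriticalPhenomena-4575`, closed), coupling seat `prim-cplus-coupling` (gen 15).  No
definitions, no named facts, no sorries; standard axioms.

`Q7Psi.gluedPreFKG_three` (gen 14) is (41) in the glued graph `G/N` with designation in `G` (Kozma–Nitzan Question 9 at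
`|A| = 3`): for `μ(z↔b) ≤ μ(x↔b), μ(y↔b)`,  `μ(L_z ∩ {N↔A}) ≤ μ({N↔b} ∩ {N↔A})`, `L_z = {z↔b} ∪ ({N↔z} ∩ {N↔b})`
(`= {z ↔ b in G/N}`), `A = {x,y,z}`.  For gluing arguments in which the ranking of the relays is known only approximately
(prim-lf-3, LF3-BETA-R §18: atoms of the 2+m kernel where the `K_u`-ranking flips after gluing) the hypothesis-free form
with ONE deficit is the usable one.  From the max-robust glued (GΨ₃) of `…Q7PsiMaxRobust.lean` (`λ* + μ* ≤ 1`):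

* `Q7Psi.glued_q7_of_psi_robust` — the peeling step as an inequality between DIFFERENCES for an arbitrary left event `X`:
  `μ(X ∩ {N↔A}) − μ({N↔b} ∩ {N↔A}) ≤ μ(X ∩ J) − μ({N↔b} ∩ J)`, `J = ⋃_{a∈A} {N ↔ a in G∖b}`;
* `Q7Psi.gluedPreFKG_three_maxrobust` — for EVERY weight vector, `N ∌ b`, `x, y, z ≠ b` distinct, NO reliability hypothesis:
  `μ(L_z ∩ {N↔A}) − μ({N↔b} ∩ {N↔A}) ≤ max(μ(z↔b) − μ(x↔b), μ(z↔b) − μ(y↔b), 0)`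
  (written with `min` on the left); `Q7Psi.gluedPreFKG_three_maxslack` — the `δ`-form.
The deficit is measured in `G` (unglued reliabilities); prim-lf-3's stronger 'CLUB' (deficit measured in `G/N`) is NOT
claimed here (memo A5-COUPLING-gen15.md).
[cite: KozmaNitzan2024, Question 9 (p. 36), Question 7 (p. 36), Lemma 5 (p. 13), §5.1 (pp. 31–32)]
-/

namespace Summit.CriticalPhenomena.PercolationContinuityZ3.Theorems

open MeasureTheory Set Literature.Probability.LatticeModels Literature.Probability.Percolation
open scoped Classical
open KNPreFKG

noncomputable section

namespace Q7Psi

universe u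

variable {V : Type u} [Fintype V]

/-- **Peeling step as an inequality of differences, arbitrary left event** (cf. `Q7Psi.glued_q7_of_psi`,
`Q7Psi.q7_of_psi_robust`): with `J = ⋃_{a∈A} {N ↔ a in G∖b}` and `U = ⋃_{a∈A} {N ↔ a}`,
`μ(X ∩ U) − μ({N↔b} ∩ U) ≤ μ(X ∩ J) − μ({N↔b} ∩ J)` — on `U ∖ J` the observer set is joined to `b`.
[cite: KozmaNitzan2024, Question 9 (p. 36)] -/
theorem glued_q7_of_psi_robust (w : Sym2 V → unitInterval) (N : Set V) (b : V) (X : Set (BondConfig V)) (A : Finset V) :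
    (prodBernoulli w).real (X ∩ ⋃ a ∈ A, {ω : BondConfig V | ∃ n ∈ N, (openGraph ω).Reachable n a}) -
        (prodBernoulli w).real ({ω : BondConfig V | ∃ n ∈ N, (openGraph ω).Reachable n b} ∩
          ⋃ a ∈ A, {ω : BondConfig V | ∃ n ∈ N, (openGraph ω).Reachable n a}) ≤
      (prodBernoulli w).real (X ∩ ⋃ a ∈ A, {ω : BondConfig V | ∃ n ∈ N, ω ∈ openConnIn ({b}ᶜ : Set V) n a}) -
        (prodBernoulli w).real ({ω : BondConfig V | ∃ n ∈ N, (openGraph ω).Reachable n b} ∩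
          ⋃ a ∈ A, {ω : BondConfig V | ∃ n ∈ N, ω ∈ openConnIn ({b}ᶜ : Set V) n a}) := by
  set μ := prodBernoulli w with hμ
  set J : Set (BondConfig V) := ⋃ a ∈ A, {ω : BondConfig V | ∃ n ∈ N, ω ∈ openConnIn ({b}ᶜ : Set V) n a} with hJ
  set U : Set (BondConfig V) := ⋃ a ∈ A, {ω : BondConfig V | ∃ n ∈ N, (openGraph ω).Reachable n a} with hU
  set Ob : Set (BondConfig V) := {ω : BondConfig V | ∃ n ∈ N, (openGraph ω).Reachable n b} with hOb
  have hJU : J ⊆ U := by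
    intro ω hω
    simp only [hJ, hU, mem_iUnion, mem_setOf_eq] at hω ⊢
    obtain ⟨a, ha, n, hn, h⟩ := hω
    exact ⟨a, ha, n, hn, KNPreFKG.reachable_of_openConnIn h⟩
  have hUJ : U \ J ⊆ Ob := by
    rintro ω ⟨hωU, hωJ⟩
    simp only [hJ, hU, mem_iUnion, mem_setOf_eq] at hωU hωJ
    obtain ⟨a, ha, n, hn, h⟩ := hωU
    have hn' : ω ∉ openConnIn ({b}ᶜ : Set V) n a := fun h' => hωJ ⟨a, ha, n, hn, h'⟩
    exact ⟨n, hn, reachable_of_not_openConnIn_compl h hn'⟩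
  have msplit : ∀ Y : Set (BondConfig V), μ.real (Y ∩ U) = μ.real (Y ∩ J) + μ.real (Y ∩ (U \ J)) := by
    intro Y
    have hdj : Disjoint (Y ∩ J) (Y ∩ (U \ J)) := by
      rw [Set.disjoint_left]
      rintro ω ⟨-, hωJ⟩ ⟨-, -, hωJ'⟩
      exact hωJ' hωJ
    rw [← measureReal_union hdj MeasurableSet.of_discrete]
    congr 1
    ext ω
    simp only [mem_inter_iff, mem_union, mem_sdiff]
    constructor
    · rintro ⟨hY, hωU⟩
      by_cases hωJ : ω ∈ J
      · exact Or.inl ⟨hY, hωJ⟩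
      · exact Or.inr ⟨hY, hωU, hωJ⟩
    · rintro (⟨hY, hωJ⟩ | ⟨hY, hωU, -⟩)
      · exact ⟨hY, hJU hωJ⟩
      · exact ⟨hY, hωU⟩
  have h1 : μ.real (X ∩ (U \ J)) ≤ μ.real (U \ J) := measureReal_mono inter_subset_right
  have h2 : μ.real (Ob ∩ (U \ J)) = μ.real (U \ J) := by
    congr 1
    exact inter_eq_right.2 hUJ
  rw [msplit X, msplit Ob, h2]
  linarith

/-- **The glued (41) at three relays, MAX-ROBUST form (no designation hypothesis), every weight vector.**  For an observer set
`N ∌ b` and distinct relays `x, y, z ≠ b`, with `L_z = {z↔b} ∪ ({N↔z} ∩ {N↔b})` (`= {z ↔ b in G/N}`) and `A = {x,y,z}`: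
`min(μ(x↔b) − μ(z↔b), μ(y↔b) − μ(z↔b), 0) ≤ μ({N↔b} ∩ {N↔A}) − μ(L_z ∩ {N↔A})`, i.e.
`μ(L_z ∩ {N↔A}) − μ({N↔b} ∩ {N↔A}) ≤ (μ(z↔b) − min(μ(x↔b), μ(y↔b)))⁺` with reliabilities measured in `G` (unglued).
At `μ(z↔b) ≤ μ(x↔b), μ(y↔b)` this is `gluedPreFKG_three`.  Proof: `glued_q7_of_psi_robust`; on `J_z = {N↔z in G∖b}` the
left event IS `{N↔b}` (the `J_z`-parts cancel); off `J_z` it is `{z↔b}`; the two green bridges and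
`gpsi_three_glued_maxrobust` on `G ∖ b`.
[cite: KozmaNitzan2024, Question 9 (p. 36), Question 7 (p. 36), Lemma 5 (p. 13), §5.1 (pp. 31–32)] -/
theorem gluedPreFKG_three_maxrobust (w : Sym2 V → unitInterval) (N : Set V) (b x y z : V) (hbN : b ∉ N)
    (hxb : x ≠ b) (hyb : y ≠ b) (hzb : z ≠ b) (hxy : x ≠ y) (hxz : x ≠ z) (hyz : y ≠ z) :
    min (min ((prodBernoulli w).real (openConn x b) - (prodBernoulli w).real (openConn z b))
        ((prodBernoulli w).real (openConn y b) - (prodBernoulli w).real (openConn z b))) 0 ≤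
      (prodBernoulli w).real ({ω : BondConfig V | ∃ n ∈ N, (openGraph ω).Reachable n b} ∩
        ⋃ a ∈ ({x, y, z} : Finset V), {ω : BondConfig V | ∃ n ∈ N, (openGraph ω).Reachable n a}) -
      (prodBernoulli w).real ((openConn z b ∪ ({ω : BondConfig V | ∃ n ∈ N, (openGraph ω).Reachable n z} ∩
        {ω : BondConfig V | ∃ n ∈ N, (openGraph ω).Reachable n b})) ∩
        ⋃ a ∈ ({x, y, z} : Finset V), {ω : BondConfig V | ∃ n ∈ N, (openGraph ω).Reachable n a}) := by
  classical
  set μ := prodBernoulli w with hμ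
  have hmeas : ∀ T : Set (BondConfig V), MeasurableSet T := fun _ => MeasurableSet.of_discrete
  set Ob : Set (BondConfig V) := {ω : BondConfig V | ∃ n ∈ N, (openGraph ω).Reachable n b} with hOb
  set Oz : Set (BondConfig V) := {ω : BondConfig V | ∃ n ∈ N, (openGraph ω).Reachable n z} with hOz
  set L : Set (BondConfig V) := openConn z b ∪ (Oz ∩ Ob) with hL
  -- (1) reduction to the peeled form (as an inequality of differences)
  have hred := glued_q7_of_psi_robust w N b L ({x, y, z} : Finset V)
  set Jx : Set (BondConfig V) := {ω : BondConfig V | ∃ n ∈ N, ω ∈ openConnIn ({b}ᶜ : Set V) n x} with hJx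
  set Jy : Set (BondConfig V) := {ω : BondConfig V | ∃ n ∈ N, ω ∈ openConnIn ({b}ᶜ : Set V) n y} with hJy
  set Jz : Set (BondConfig V) := {ω : BondConfig V | ∃ n ∈ N, ω ∈ openConnIn ({b}ᶜ : Set V) n z} with hJz
  have hJ : ∀ X : Set (BondConfig V),
      X ∩ (⋃ a ∈ ({x, y, z} : Finset V), {ω : BondConfig V | ∃ n ∈ N, ω ∈ openConnIn ({b}ᶜ : Set V) n a}) =
      X ∩ ((Jx ∪ Jy) ∪ Jz) := by
    intro X; congr 1; ext ω
    simp only [hJx, hJy, hJz, Finset.mem_insert, Finset.mem_singleton, mem_iUnion, mem_union, mem_setOf_eq,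
      exists_prop]
    constructor
    · rintro ⟨a, ha, n, hn, h⟩
      rcases ha with rfl | rfl | rfl
      · exact Or.inl (Or.inl ⟨n, hn, h⟩)
      · exact Or.inl (Or.inr ⟨n, hn, h⟩)
      · exact Or.inr ⟨n, hn, h⟩
    · rintro ((⟨n, hn, h⟩ | ⟨n, hn, h⟩) | ⟨n, hn, h⟩)
      · exact ⟨x, Or.inl rfl, n, hn, h⟩
      · exact ⟨y, Or.inr (Or.inl rfl), n, hn, h⟩
      · exact ⟨z, Or.inr (Or.inr rfl), n, hn, h⟩
  rw [hJ, hJ] at hred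
  -- (2) split along `J_z`: there the left event is `{N↔b}`; off `J_z` it is `{z↔b}`
  have hLJz : L ∩ Jz = Ob ∩ Jz := by
    ext ω
    simp only [hL, hOb, hOz, hJz, mem_inter_iff, mem_union, mem_setOf_eq]
    constructor
    · rintro ⟨hLω, n, hn, hnz⟩
      refine ⟨?_, n, hn, hnz⟩
      rcases hLω with hzb' | ⟨_, hb'⟩
      · exact ⟨n, hn, (reachable_of_openConnIn hnz).trans hzb'⟩
      · exact hb'
    · rintro ⟨hb', n, hn, hnz⟩
      exact ⟨Or.inr ⟨⟨n, hn, reachable_of_openConnIn hnz⟩, hb'⟩, n, hn, hnz⟩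
  have hLJzc : L ∩ Jzᶜ = openConn z b ∩ Jzᶜ := by
    ext ω
    simp only [hL, hOb, hOz, hJz, mem_inter_iff, mem_union, mem_compl_iff, mem_setOf_eq, not_exists, not_and]
    constructor
    · rintro ⟨hLω, hnJ⟩
      refine ⟨?_, hnJ⟩
      rcases hLω with hzb' | ⟨⟨n, hn, hnz⟩, _⟩
      · exact hzb'
      · exact hnz.symm.trans (reachable_of_not_openConnIn_compl hnz (hnJ n hn))
    · rintro ⟨hzb', hnJ⟩
      exact ⟨Or.inl hzb', hnJ⟩
  have msplit : ∀ X : Set (BondConfig V), μ.real (X ∩ ((Jx ∪ Jy) ∪ Jz)) =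
      μ.real ((X ∩ Jz) ∩ ((Jx ∪ Jy) ∪ Jz)) + μ.real ((X ∩ Jzᶜ) ∩ (Jx ∪ Jy)) := by
    intro X
    have hdj : Disjoint ((X ∩ Jz) ∩ ((Jx ∪ Jy) ∪ Jz)) ((X ∩ Jzᶜ) ∩ (Jx ∪ Jy)) := by
      rw [Set.disjoint_left]
      rintro ω ⟨⟨-, h⟩, -⟩ ⟨⟨-, hn⟩, -⟩
      exact hn h
    rw [← measureReal_union hdj (hmeas _)]
    congr 1
    ext ω
    simp only [mem_inter_iff, mem_union, mem_compl_iff]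
    tauto
  rw [msplit L, msplit Ob, hLJz, hLJzc] at hred
  suffices key : min (min (μ.real (openConn x b) - μ.real (openConn z b))
        (μ.real (openConn y b) - μ.real (openConn z b))) 0 ≤
      μ.real ((Ob ∩ Jzᶜ) ∩ (Jx ∪ Jy)) - μ.real ((openConn z b ∩ Jzᶜ) ∩ (Jx ∪ Jy)) by linarith
  -- (3) pass to `G ∖ b`
  set S : Set V := {b}ᶜ with hS
  set r := restrictConfig (Subtype.val : S → V) with hr
  set w' : Sym2 S → unitInterval := w ∘ Sym2.map (Subtype.val : S → V) with hw'
  set μ' := prodBernoulli w' with hμ'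
  set x' : S := ⟨x, mem_compl_singleton_iff.2 hxb⟩ with hx'
  set y' : S := ⟨y, mem_compl_singleton_iff.2 hyb⟩ with hy'
  set z' : S := ⟨z, mem_compl_singleton_iff.2 hzb⟩ with hz'
  set N' : Set S := (Subtype.val : S → V) ⁻¹' N with hN'
  set E₀ : Set (BondConfig S) := ({ω' : BondConfig S | ∃ n ∈ N', (openGraph ω').Reachable x' n} ∪
      {ω' | ∃ n ∈ N', (openGraph ω').Reachable y' n}) ∩ {ω' | ∀ n ∈ N', ¬ (openGraph ω').Reachable z' n} with hE₀
  have hnb : ∀ n ∈ N, n ≠ b := fun n hn h => hbN (h ▸ hn)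
  have hJpre : ∀ (v : V) (hvb : v ≠ b),
      {ω : BondConfig V | ∃ n ∈ N, ω ∈ openConnIn ({b}ᶜ : Set V) n v} =
        r ⁻¹' {ω' : BondConfig S | ∃ n ∈ N', (openGraph ω').Reachable ⟨v, mem_compl_singleton_iff.2 hvb⟩ n} := by
    intro v hvb; ext ω
    simp only [mem_setOf_eq, mem_preimage, hN']
    constructor
    · rintro ⟨n, hn, h⟩
      refine ⟨⟨n, mem_compl_singleton_iff.2 (hnb n hn)⟩, hn, ?_⟩
      rw [reachable_restrictConfig_val_iff]
      rw [openConnIn_comm]; exact h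
    · rintro ⟨n', hn', h⟩
      refine ⟨n', hn', ?_⟩
      rw [reachable_restrictConfig_val_iff] at h
      rw [openConnIn_comm]; exact h
  have hJE : Jzᶜ ∩ (Jx ∪ Jy) = r ⁻¹' E₀ := by
    rw [hE₀, preimage_inter, preimage_union, hJx, hJy, hJz, hJpre x hxb, hJpre y hyb, hJpre z hzb, inter_comm,
      ← preimage_compl]
    congr 2
    ext ω'
    simp only [mem_compl_iff, mem_setOf_eq, not_exists, not_and]
    exact Iff.rfl
  have hJE' : ∀ X : Set (BondConfig V), (X ∩ Jzᶜ) ∩ (Jx ∪ Jy) = X ∩ r ⁻¹' E₀ := by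
    intro X; rw [inter_assoc, hJE]
  rw [hJE', hJE']
  -- the green function and the two bridges
  set F : Set S → ℝ := fun T => μ.real {ω₁ : BondConfig V | ∃ s ∈ Subtype.val '' T, s ≠ b ∧ s(b, s) ∈ ω₁} with hF
  have hFmono : ∀ T T' : Set S, T ⊆ T' → F T ≤ F T' := by
    intro T T' hTT'
    refine measureReal_mono fun ω₁ hω₁ => ?_
    obtain ⟨s, hs, hsb, hso⟩ := hω₁
    exact ⟨s, image_mono hTT' hs, hsb, hso⟩
  have hbridge : ∀ (v : V) (hvb : v ≠ b) (E₁ : Set (BondConfig S)),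
      μ.real (openConn v b ∩ r ⁻¹' E₁) = ∫ ω' in E₁, F (openCluster ω' ⟨v, mem_compl_singleton_iff.2 hvb⟩) ∂μ' := by
    intro v hvb E₁
    rw [inter_comm, hr, real_inter_openConn_eq_integral_green w b v hvb E₁, ← integral_indicator (hmeas _),
      hμ', hw', ← integral_indicator (MeasurableSet.of_discrete), ← integral_comp_restrictConfig_val]
    refine integral_congr_ae (Filter.Eventually.of_forall fun ω => ?_)
    change (restrictConfig Subtype.val ⁻¹' E₁).indicator _ ω = E₁.indicator _ (restrictConfig Subtype.val ω)
    have hfun : (fun ω : BondConfig V => μ.real {ω₁ : BondConfig V | ∃ s ∈ {y | ω ∈ openConnIn ({b}ᶜ : Set V) v y},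
        s ≠ b ∧ s(b, s) ∈ ω₁}) =
        (fun ω' => F (openCluster ω' ⟨v, mem_compl_singleton_iff.2 hvb⟩)) ∘ restrictConfig (Subtype.val : S → V) := by
      funext ω
      simp only [Function.comp_apply, hF]
      rw [setOf_openConnIn_eq_image b ω ⟨v, mem_compl_singleton_iff.2 hvb⟩]
    rw [hfun]
    exact indicator_comp_right _
  have hsetcl : ∀ ω : BondConfig V, {y | ∃ n ∈ N, ω ∈ openConnIn ({b}ᶜ : Set V) n y} =
      Subtype.val '' ⋃ n ∈ N', openCluster (restrictConfig (Subtype.val : S → V) ω) n := by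
    intro ω
    rw [image_iUnion₂]
    ext v
    simp only [mem_setOf_eq, mem_iUnion, hN', mem_preimage, exists_prop]
    constructor
    · rintro ⟨n, hn, h⟩
      refine ⟨⟨n, mem_compl_singleton_iff.2 (hnb n hn)⟩, hn, ?_⟩
      rw [← setOf_openConnIn_eq_image b ω ⟨n, _⟩]
      exact h
    · rintro ⟨n', hn', h⟩
      refine ⟨n', hn', ?_⟩
      rw [← setOf_openConnIn_eq_image b ω n'] at h
      exact h
  have hbridgeN : ∀ (E₁ : Set (BondConfig S)),
      μ.real (Ob ∩ r ⁻¹' E₁) = ∫ ω' in E₁, F (⋃ n ∈ N', openCluster ω' n) ∂μ' := by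
    intro E₁
    rw [inter_comm, hr, hOb, real_inter_setReach_eq_integral_green w b N hbN E₁, ← integral_indicator (hmeas _),
      hμ', hw', ← integral_indicator (MeasurableSet.of_discrete), ← integral_comp_restrictConfig_val]
    refine integral_congr_ae (Filter.Eventually.of_forall fun ω => ?_)
    change (restrictConfig Subtype.val ⁻¹' E₁).indicator _ ω = E₁.indicator _ (restrictConfig Subtype.val ω)
    have hfun : (fun ω : BondConfig V => μ.real {ω₁ : BondConfig V | ∃ s ∈ {y | ∃ n ∈ N, ω ∈ openConnIn ({b}ᶜ : Set V) n y},
        s ≠ b ∧ s(b, s) ∈ ω₁}) =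
        (fun ω' => F (⋃ n ∈ N', openCluster ω' n)) ∘ restrictConfig (Subtype.val : S → V) := by
      funext ω
      simp only [Function.comp_apply, hF]
      rw [hsetcl ω]
    rw [hfun]
    exact indicator_comp_right _
  have htau : ∀ (v : V) (hvb : v ≠ b), μ.real (openConn v b) =
      ∫ ω', F (openCluster ω' ⟨v, mem_compl_singleton_iff.2 hvb⟩) ∂μ' := by
    intro v hvb
    rw [← setIntegral_univ, ← hbridge v hvb univ, preimage_univ, inter_univ]
  have hxy' : x' ≠ y' := fun h => hxy (congrArg Subtype.val h)
  have hxz' : x' ≠ z' := fun h => hxz (congrArg Subtype.val h)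
  have hyz' : y' ≠ z' := fun h => hyz (congrArg Subtype.val h)
  rw [hbridge z hzb E₀, hbridgeN E₀, htau x hxb, htau y hyb, htau z hzb]
  exact gpsi_three_glued_maxrobust w' x' y' z' N' hxy' hxz' hyz' F hFmono

/-- **The glued (41) at three relays with ONE `δ` of slack.**  `N ∌ b`, distinct `x, y, z ≠ b`, `A = {x,y,z}`,
`L_z = {z↔b} ∪ ({N↔z} ∩ {N↔b})`: if `μ(z↔b) ≤ μ(x↔b) + δ` and `μ(z↔b) ≤ μ(y↔b) + δ`, `δ ≥ 0`, then
`μ(L_z ∩ {N↔A}) ≤ μ({N↔b} ∩ {N↔A}) + δ`.  (`δ = 0`: `gluedPreFKG_three`.)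
[cite: KozmaNitzan2024, Question 9 (p. 36)] -/
theorem gluedPreFKG_three_maxslack (w : Sym2 V → unitInterval) (N : Set V) (b x y z : V) (hbN : b ∉ N)
    (hxb : x ≠ b) (hyb : y ≠ b) (hzb : z ≠ b) (hxy : x ≠ y) (hxz : x ≠ z) (hyz : y ≠ z) (δ : ℝ) (hδ : 0 ≤ δ)
    (hzx : (prodBernoulli w).real (openConn z b) ≤ (prodBernoulli w).real (openConn x b) + δ)
    (hzy : (prodBernoulli w).real (openConn z b) ≤ (prodBernoulli w).real (openConn y b) + δ) :
    (prodBernoulli w).real ((openConn z b ∪ ({ω : BondConfig V | ∃ n ∈ N, (openGraph ω).Reachable n z} ∩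
        {ω : BondConfig V | ∃ n ∈ N, (openGraph ω).Reachable n b})) ∩
        ⋃ a ∈ ({x, y, z} : Finset V), {ω : BondConfig V | ∃ n ∈ N, (openGraph ω).Reachable n a}) ≤
      (prodBernoulli w).real ({ω : BondConfig V | ∃ n ∈ N, (openGraph ω).Reachable n b} ∩
        ⋃ a ∈ ({x, y, z} : Finset V), {ω : BondConfig V | ∃ n ∈ N, (openGraph ω).Reachable n a}) + δ := by
  have key := gluedPreFKG_three_maxrobust w N b x y z hbN hxb hyb hzb hxy hxz hyz
  have h1 : -δ ≤ min (min ((prodBernoulli w).real (openConn x b) - (prodBernoulli w).real (openConn z b))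
      ((prodBernoulli w).real (openConn y b) - (prodBernoulli w).real (openConn z b))) 0 :=
    le_min (le_min (by linarith) (by linarith)) (by linarith)
  linarith

end Q7Psi

end

end Summit.CriticalPhenomena.PercolationContinuityZ3.Theorems
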